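import Summits.BirchSwinnertonDyer.Rank1Residual.AdditivePotMult.QuadraticBaseChangeOddTamagawaAdditiveOddPrime
import Summits.BirchSwinnertonDyer.Rank1Residual.AdditivePotMult.QuadraticTwistTamagawaTypeIVPlaceTwo
import HarnessLib

/-!
# The odd Tamagawa identity at EVERY odd `p` with additive places prime to `d_K` allowed, the
# inert `2` of type `IV` / `IV*` INCLUDED (row T-MIL-3, FILE H-5a — FILE H-1 with its `ℓ = 2`
# clause discharged by row T-MIL-B2; seat n1011-p01 GEN 8)

HONEST FRAMING (cell `b2b-bsdres`, run/shared/lean/b2b/bsd-rank1-residual/, verbatim in every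
file): the goal of the cell is to DELETE the COMBINATION-SHAPED residual classes of the
Birch–Swinnerton-Dyer formula for ALL analytic-rank `≤ 1` elliptic curves over `ℚ` — "full BSD
formula for every rank `≤ 1` curve in class `C`" assembled STRICTLY from published theorems — so
that the rank-`≤ 1` remainder becomes exactly the CONSTRUCTION-SHAPED classes, which are TYPED
(missing-input `Prop`s), NOT attempted. This is not "finishing BSD". Sub-classes X3♯(M) / X4(M)
(additive, potentially multiplicative prime; base-change-and-descend): a RESEARCH ROUTE; they stay
CONSTRUCTION-SHAPED; nothing is booked by this file; no mark / label moved. THEOREMS ONLY: no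
definition, no named fact, no `sorry`.

## What

FILE H-1 (`QuadraticBaseChangeOddTamagawaAdditiveOddPrime`) proves the odd Tamagawa identity of
Milne's quadratic BSD quotient at every odd `p`, the price of `p = 3` being the proviso
`p = 3 → ℓ_v ≠ 3 ∧ (ℓ_v = 2 → d_K % 8 = 1 ∨ (W.kodairaSymbolAt v ≠ IV ∧ W.kodairaSymbolAt v ≠ IV*))`
inside the additive disjunct of the local hypothesis: at an INERT `2` (`d_K ≡ 5 mod 8`, e.g.
`K = ℚ(√−3)`) the Kodaira types `IV` / `IV*` were excluded, the unit-twist FLIP over the residue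
field `𝔽₂` not being in the tree. Row T-MIL-B2 (n1011-p16, `QuadraticTwistTamagawaTypeIVFlipTwo` /
`QuadraticTwistTamagawaTypeIVPlaceTwo`) has since proved it FACT-FREE (Artin–Schreier form of
*ATAEC* IV.9.4 Steps 5/8 over `𝔽₂`) together with the fibre sums
`TypeIVTwistTwo.sum_fibre_padicValNat_localTamagawaNumber_of_kodairaSymbolAt_eq_IV[star]_of_inert_two`
(`d_K % 8 = 5`). This file consumes them BY NAME and drops the `ℓ = 2` clause:

* `sum_fibre_padicValNat_localTamagawaNumber_of_semistable_or_addv_of_unramifiedFact_oddPrime` — (T)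
  at a place, every odd `p`, the additive disjunct carrying ONLY `p = 3 → ℓ_v ≠ 3`;
* **`padicValRat_norm_mul_tamagawaProduct_eq_of_unramifiedFact_oddPrime` — THE END at every odd `p`
  with hypothesis `hS : ∀ v`, `W` good ∨ multiplicative ∨ (`ℓ_v ∣ d_K` ∧ `W_d` multiplicative) ∨
  (`W` additive ∧ `ℓ_v ∤ d_K` ∧ (`p = 3 → ℓ_v ≠ 3`))** — for `p ∣ d_K` (the in-class case, `K`
  ramified at `p`) this is C-3h's S₃ hypothesis VERBATIM, now at every odd `p`; CONDITIONAL on A233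
  (`hA`, for `W` only) exactly as H-1 / C-3h.

Mechanism at an inert `2` of type `IV`/`IV*` (`p = 3`): `d_K` odd (`hdodd`) gives `d_K ≡ 1 (mod 4)`
(`discr_emod_four`), inertness refutes `d_K % 8 = 1` (`ncard_primesOver_eq_one_of_fibre_singleton` +
`Quadratic.ncard_primesOver_two_eq_two_iff`), so `d_K % 8 = 5` and T-MIL-B2's fibre sum applies.
Everything else is FILE H-1 verbatim (its per-place theorem is called with the clause fed by
`Or.inr`).

HONEST LIMITS: CONDITIONAL on A233 (`hA`; row T-A233 of n1011-p16 discharges it); NOT covered at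
`p = 3`: additive `W` at an UNRAMIFIED `3` (never in-class: the descent at `p` uses `K` ramified at
`p`); `d_K` odd squarefree; closes no class; moves no mark; H-1 / C-3h stay as dominated twins.

References: Silverman *ATAEC* Cor. IV.9.2, Thm. IV.9.4 Steps 5/8, Table 4.1 [SilvermanATAEC1994];
*AEC* Prop. VII.5.4 (a), VII.6.1 [SilvermanAEC2009]; Milne 1972 §1 [Milne1972ArithmeticAV];
[DokchitserDokchitserAnnals2010] §2.1.
-/

noncomputable section

open scoped Classical NumberField

open WeierstrassCurve NumberField IsDedekindDomain Rat.HeightOneSpectrum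
  Literature.NumberTheory.EllipticCurves Literature.NumberTheory.DiophantineGeometry IsLocalRing
  Summit.BirchSwinnertonDyer.Rank1Residual.Additive

namespace Summit.BirchSwinnertonDyer.Rank1Residual.AdditivePotMult

section End

variable (W : WeierstrassCurve ℚ) [W.IsElliptic] [W.IsGloballyMinimal]
  (K : Type) [Field K] [NumberField K] (Wd : WeierstrassCurve ℚ) [Wd.IsElliptic] [Wd.IsGloballyMinimal]
  (W' : WeierstrassCurve K) [W'.IsGloballyMinimal]

/-- **(T) at a place from the local S₃ hypothesis with ONLY the proviso `p = 3 → ℓ_v ≠ 3`, every odd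
`p`, GIVEN A233 above `v`** (`W/ℚ` globally minimal, `K` quadratic, `d_K` odd squarefree,
`W_d = C_d • W^{(d_K)}`): `Σ_{w | v} v_p(c_w(W_K)) = v_p(c_v(W)) + v_p(c_v(W_d))`. FILE H-1's
per-place theorem, except at `p = 3` at an INERT `2` of Kodaira type `IV` / `IV*`, where
`d_K % 8 = 5` (odd `d_K`, `2` inert) and row T-MIL-B2's
`TypeIVTwistTwo.sum_fibre_padicValNat_localTamagawaNumber_of_kodairaSymbolAt_eq_IV[star]_of_inert_two`
(n1011-p16, fact-free `𝔽₂` flip) gives `1 = 1 + 0` / `1 = 0 + 1`. CONDITIONAL on `hA` (W only).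
[cite: SilvermanAEC2009, Prop. VII.5.4 (a) and Thm. VII.6.1] [cite: SilvermanATAEC1994, IV.9.4 Steps 5, 8 and Table 4.1] -/
theorem sum_fibre_padicValNat_localTamagawaNumber_of_semistable_or_addv_of_unramifiedFact_oddPrime
    (h2 : Module.finrank ℚ K = 2)
    (hdodd : Odd (NumberField.discr K)) (hdsq : Squarefree (NumberField.discr K))
    {Cd : VariableChange ℚ} (hWd : Cd • W.quadraticTwist (NumberField.discr K : ℚ) = Wd)
    (p : ℕ) [hp : Fact p.Prime] (hp2 : p ≠ 2) (v : HeightOneSpectrum (𝓞 ℚ))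
    (hA : ∀ w : HeightOneSpectrum (𝓞 K), kodairaSymbolAt_baseChange_of_ramificationIdx_eq_one K v w W)
    (hSv : W.HasGoodReductionAt v ∨ W.HasMultiplicativeReductionAt v ∨
      (((primesEquiv v : ℕ) : ℤ) ∣ NumberField.discr K ∧ Wd.HasMultiplicativeReductionAt v) ∨
      (W.HasAdditiveReductionAt v ∧ ¬ ((primesEquiv v : ℕ) : ℤ) ∣ NumberField.discr K ∧
        (p = 3 → (primesEquiv v : ℕ) ≠ 3))) :
    ∑ w ∈ (HeightOneSpectrum.finite_setOf_under_eq_of_numberField (K := K) v).toFinset,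
        padicValNat p (((W.baseChange K).baseChange (w.adicCompletion K)).localTamagawaNumber
          (w.adicCompletionIntegers K)) =
      padicValNat p ((W.baseChange (v.adicCompletion ℚ)).localTamagawaNumber
          (v.adicCompletionIntegers ℚ)) +
        padicValNat p ((Wd.baseChange (v.adicCompletion ℚ)).localTamagawaNumber
          (v.adicCompletionIntegers ℚ)) := by
  -- the H-1 theorem handles everything except (`p = 3`, inert `2`, type `IV`/`IV*`)
  have hH1 := sum_fibre_padicValNat_localTamagawaNumber_of_semistable_or_addv_of_unramifiedFact_odd W K
    Wd h2 hdodd hdsq hWd p hp2 v hA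
  rcases hSv with h | h | h | ⟨hadd, hnd, hprov⟩
  · exact hH1 (Or.inl h)
  · exact hH1 (Or.inr (Or.inl h))
  · exact hH1 (Or.inr (Or.inr (Or.inl h)))
  by_cases hcase : p = 3 ∧ (primesEquiv v : ℕ) = 2 ∧
      (W.kodairaSymbolAt v = .IV ∨ W.kodairaSymbolAt v = .IVstar)
  · obtain ⟨hp3, hv2, hIV⟩ := hcase
    subst hp3
    have hd4 : NumberField.discr K % 4 = 1 := by
      rcases Literature.NumberTheory.QuadraticFields.Quadratic.discr_emod_four h2 with h | h
      · exfalso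
        obtain ⟨k, hk⟩ := hdodd
        omega
      · exact h
    rcases placesOver_trichotomy_of_finrank_eq_two K h2 v with
      ⟨w₁, w₂, hne, hset, hef⟩ | ⟨w, hset, he, hf⟩ | ⟨w, hset, he, hf⟩
    · exact sum_fibre_padicValNat_localTamagawaNumber_of_split W Wd 3 v h2 hWd hne hset hef
    · -- inert `2`: `d_K % 8 = 5`
      have h8 : NumberField.discr K % 8 ≠ 1 := by
        intro h8
        have hsplit :=
          (Literature.NumberTheory.QuadraticFields.Quadratic.ncard_primesOver_two_eq_two_iff h2).mpr h8
        have h1 := ncard_primesOver_eq_one_of_fibre_singleton K v hset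
        rw [hv2] at h1
        simp only [Nat.cast_ofNat] at h1
        rw [h1] at hsplit
        exact absurd hsplit (by decide)
      have hd8 : NumberField.discr K % 8 = 5 := by omega
      rcases hIV with hIV | hIV
      · exact TypeIVTwistTwo.sum_fibre_padicValNat_localTamagawaNumber_of_kodairaSymbolAt_eq_IV_of_inert_two
          W Wd v hWd hd8 hv2 hIV hset he hf
      · exact TypeIVTwistTwo.sum_fibre_padicValNat_localTamagawaNumber_of_kodairaSymbolAt_eq_IVstar_of_inert_two
          W Wd v hWd hd8 hv2 hIV hset he hf
    · exact absurd (natCast_dvd_discr_of_ramificationIdx_eq_two K v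
        (under_eq_of_fibre_eq_singleton hset) he) hnd
  · refine hH1 (Or.inr (Or.inr (Or.inr ⟨hadd, hnd, fun hp3 => ⟨hprov hp3, fun hv2 => Or.inr ?_⟩⟩)))
    constructor
    · intro hIV
      exact hcase ⟨hp3, hv2, Or.inl hIV⟩
    · intro hIVs
      exact hcase ⟨hp3, hv2, Or.inr hIVs⟩

/-- **THE END at EVERY ODD `p` (`p = 3` included), additive places prime to `d_K` of EVERY Kodaira
type allowed (the inert `2` of type `IV`/`IV*` included), CONDITIONAL on A233.** For `W/ℚ` globally
minimal elliptic, `K` quadratic with `d_K` odd squarefree, globally minimal `W_d = C_d • W^{(d_K)}`,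
`W' = C' • W_K`, the named fact A233 at every `(v, w)` as `hA`, and `hS : ∀ v`, `W` good ∨ `W`
multiplicative ∨ (`ℓ_v ∣ d_K` ∧ `W_d` multiplicative) ∨ (`W` additive ∧ `ℓ_v ∤ d_K` ∧
(`p = 3 → ℓ_v ≠ 3`)), every odd prime `p`:
`v_p(|N_{K/ℚ}(C'.u)| · ∏_w c_w(W')) = v_p(|C_d.u| · ∏_v c_v(W) · ∏_v c_v(W_d))` — the body of `hodd`.
For `p ∣ d_K` (the in-class case) the last clause is automatic and `hS` is C-3h's S₃ hypothesis
verbatim. Assembly as H-1 (C-2 schema; (D) at `v₀ ↔ p` from C-3g). H-1's END is the dominated twin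
(its `ℓ = 2` clause fed by `Or.inr`). CONDITIONAL on `hA`; closes no class.
[cite: Milne1972ArithmeticAV, §1 Thm. 1 and §2 (through DokchitserDokchitserAnnals2010, §2.1, proof of Thm. 8)]
[cite: SilvermanAEC2009, Prop. VII.5.4 (a), Thm. VII.6.1] [cite: SilvermanATAEC1994, IV.9.4 Steps 5, 8 and Table 4.1] -/
theorem padicValRat_norm_mul_tamagawaProduct_eq_of_unramifiedFact_oddPrime (h2 : Module.finrank ℚ K = 2)
    (hdodd : Odd (NumberField.discr K)) (hdsq : Squarefree (NumberField.discr K))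
    {Cd : VariableChange ℚ} (hWd : Cd • W.quadraticTwist (NumberField.discr K : ℚ) = Wd)
    {C' : VariableChange K} (hW' : C' • W.baseChange K = W')
    (hA : ∀ (v : HeightOneSpectrum (𝓞 ℚ)) (w : HeightOneSpectrum (𝓞 K)),
      kodairaSymbolAt_baseChange_of_ramificationIdx_eq_one K v w W)
    (p : ℕ) [hp : Fact p.Prime] (hp2 : p ≠ 2)
    (hS : ∀ v : HeightOneSpectrum (𝓞 ℚ), W.HasGoodReductionAt v ∨ W.HasMultiplicativeReductionAt v ∨
      (((primesEquiv v : ℕ) : ℤ) ∣ NumberField.discr K ∧ Wd.HasMultiplicativeReductionAt v) ∨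
      (W.HasAdditiveReductionAt v ∧ ¬ ((primesEquiv v : ℕ) : ℤ) ∣ NumberField.discr K ∧
        (p = 3 → (primesEquiv v : ℕ) ≠ 3))) :
    padicValRat p (|Algebra.norm ℚ (C'.u : K)| * W'.tamagawaProduct : ℚ) =
      padicValRat p (|(Cd.u : ℚ)| * (W.tamagawaProduct * Wd.tamagawaProduct) : ℚ) := by
  set v₀ : HeightOneSpectrum (𝓞 ℚ) := (primesEquiv (R := 𝓞 ℚ)).symm ⟨p, hp.out⟩ with hv₀def
  have hv₀ : (primesEquiv v₀ : ℕ) = p := by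
    rw [hv₀def, Equiv.apply_symm_apply]
  have hv₀2 : (primesEquiv v₀ : ℕ) ≠ 2 := by rw [hv₀]; exact hp2
  have hu' : (C'.u : K) ≠ 0 := Units.ne_zero _
  have hud : (Cd.u : ℚ) ≠ 0 := Units.ne_zero _
  have hT := fun v => sum_fibre_padicValNat_localTamagawaNumber_of_semistable_or_addv_of_unramifiedFact_oddPrime
    W K Wd h2 hdodd hdsq hWd p hp2 v (hA v) (hS v)
  -- at `v₀` the hypothesis is an S₂ hypothesis (`ℓ_{v₀} = p ≥ 5`, or `p = 3` and the proviso bites)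
  have hS₀ : W.HasGoodReductionAt v₀ ∨ W.HasMultiplicativeReductionAt v₀ ∨
      (((primesEquiv v₀ : ℕ) : ℤ) ∣ NumberField.discr K ∧ Wd.HasMultiplicativeReductionAt v₀) ∨
      (W.HasAdditiveReductionAt v₀ ∧ ¬ ((primesEquiv v₀ : ℕ) : ℤ) ∣ NumberField.discr K ∧
        5 ≤ (primesEquiv v₀ : ℕ)) := by
    rcases hS v₀ with h | h | h | ⟨ha, hn, hprov⟩
    · exact Or.inl h
    · exact Or.inr (Or.inl h)
    · exact Or.inr (Or.inr (Or.inl h))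
    · refine Or.inr (Or.inr (Or.inr ⟨ha, hn, ?_⟩))
      by_cases hp3 : p = 3
      · exact absurd hv₀ (by rw [hp3]; exact hprov hp3)
      · rw [hv₀]; exact hp.out.five_le_of_ne_two_of_ne_three hp2 hp3
  have hD := sum_fibre_inertiaDeg_mul_ord_u_eq_of_semistable_or_addv W K Wd W' h2 hdsq hWd hW' v₀
    hv₀2 hS₀
  refine padicValRat_norm_mul_tamagawaProduct_eq_of_local_baseChange W Wd W' hW' hu' hud p v₀ hv₀
    (fun v _ => hT v) ?_
  rw [Finset.sum_add_distrib, hD, ← Nat.cast_sum, hT v₀, Nat.cast_add]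

end End

end Summit.BirchSwinnertonDyer.Rank1Residual.AdditivePotMult

end
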